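import Mathlib
import HarnessLib
import Literature.Analysis.FluidPDE.SereginSverakPressureTypeI

/-!
# Route `UnthreadedRigidityDoor`, item `UnthreadedRigidity` (W2, stmt-NavierStokesRegularity-27585) — THREADING JETS, VIRIAL WEIGHTS:
# smooth plateau profiles and the homogeneity-matched radial weights `κ(s) s^{−m}` for the harmonic-free (F3) VIRIAL LEMMA (LINE g11-1)

Seat ns-crc-p1 g8 (half (B′) `VirialLemmaSlice` of dss_146 (1)), `--supports stmt-NavierStokesRegularity-27585 --as helper`.  Pure one-variable
real analysis, no fluid objects: the test profiles fed into `integral_virial_identity` (`…ThreadingJetsVirialFields`).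

* the derivative bound of Mathlib's smooth step is the tree's `SereginSverak2002.exists_abs_deriv_smoothTransition_le`;
* `risingRamp_props` (`κ₁(s) = ST((s−a)/a)`: `0` below `a`, `1` above `2a`, `|κ₁′| ≤ C/a`, `κ₁′ = 0` off `(a,2a)`),
  `fallingRamp_props` (`κ₂(s) = ST((2B−s)/B)`: `1` below `B`, `0` above `2B`, `|κ₂′| ≤ C/B`, `κ₂′ = 0` off `(B,2B)`);
* `contDiff_mul_rpow_of_eq_zero` — `κ(s) s^{−m}` is smooth on `ℝ` when `κ` vanishes below a positive level;
* `weight_deriv_identity` — `2m·θ + 2sθ′ = 2κ′ s^{1−m}` for `θ = κ s^{−m}`, `s > 0`: with `2m = 4l − 1` the `θ`-term of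
  `integral_virial_identity` CANCELS and only the ramps `κ′` survive.

HONEST FRAMING: calculus bookkeeping for the L-half of one RUNG line's bridge; nothing here bears on `UnthreadedRigidity` (27585), W2 or
Navier–Stokes regularity; no summit statement is proved. [folklore]
-/

noncomputable section

-- the summit and its single sub-problem share the name (CONVENTIONS §1), as in every Theorems file
set_option linter.dupNamespace false

namespace Summit.NavierStokesRegularity.NavierStokesRegularity.Theorems.UnthreadedRigidity.ThreadingJets

open Set Filter Topology

/-! ### 1. The smooth step and its derivative bound -/

-- the bound `∃ C ≥ 0, |ST′| ≤ C` is the tree's `Literature.Analysis.FluidPDE.SereginSverak2002.exists_abs_deriv_smoothTransition_le`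

/-! ### 2. The rising and the falling ramp -/

/-- The RISING RAMP `κ₁(s) = ST((s − a)/a)`: smooth, `0` on `(−∞, a]`, `1` on `[2a, ∞)`, values in `[0,1]`, `|κ₁′| ≤ C/a`, and `κ₁′ = 0` off `(a, 2a)`.
[folklore] -/
theorem risingRamp_props {a : ℝ} (ha : 0 < a) {C : ℝ} (hC : ∀ x : ℝ, |deriv Real.smoothTransition x| ≤ C) :
    ContDiff ℝ (⊤ : ℕ∞) (fun s : ℝ => Real.smoothTransition ((s - a) / a)) ∧
    (∀ s, s ≤ a → Real.smoothTransition ((s - a) / a) = 0) ∧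
    (∀ s, 2 * a ≤ s → Real.smoothTransition ((s - a) / a) = 1) ∧
    (∀ s, 0 ≤ Real.smoothTransition ((s - a) / a) ∧ Real.smoothTransition ((s - a) / a) ≤ 1) ∧
    (∀ s, |deriv (fun s : ℝ => Real.smoothTransition ((s - a) / a)) s| ≤ C / a) ∧
    (∀ s, s ∉ Ioo a (2 * a) → deriv (fun s : ℝ => Real.smoothTransition ((s - a) / a)) s = 0) := by
  have hlin : ∀ s, HasDerivAt (fun s : ℝ => (s - a) / a) (1 / a) s := fun s => by
    simpa using ((hasDerivAt_id s).sub_const a).div_const a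
  have hder : ∀ s, HasDerivAt (fun s : ℝ => Real.smoothTransition ((s - a) / a))
      (deriv Real.smoothTransition ((s - a) / a) * (1 / a)) s := fun s =>
    ((Real.smoothTransition.contDiffAt (n := 1)).differentiableAt (by simp)).hasDerivAt.comp s (hlin s)
  refine ⟨?_, ?_, ?_, ?_, ?_, ?_⟩
  · exact Real.smoothTransition.contDiff.comp ((contDiff_id.sub contDiff_const).div_const a)
  · intro s hs
    exact Real.smoothTransition.zero_of_nonpos (div_nonpos_of_nonpos_of_nonneg (by linarith) ha.le)
  · intro s hs
    exact Real.smoothTransition.one_of_one_le (by rw [le_div_iff₀ ha]; linarith)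
  · exact fun s => ⟨Real.smoothTransition.nonneg _, Real.smoothTransition.le_one _⟩
  · intro s
    rw [(hder s).deriv, abs_mul, abs_of_pos (one_div_pos.2 ha), ← div_eq_mul_one_div]
    exact div_le_div_of_nonneg_right (hC _) ha.le
  · intro s hs
    rw [(hder s).deriv]
    rw [mem_Ioo, not_and_or, not_lt, not_lt] at hs
    rcases hs with hs | hs
    · -- `s ≤ a`: locally constant `0`? only for `s < a`; at `s = a` the derivative of `ST` at `0` vanishes as well
      have h0 : deriv Real.smoothTransition ((s - a) / a) = 0 := by
        have hx : (s - a) / a ≤ 0 := div_nonpos_of_nonpos_of_nonneg (by linarith) ha.le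
        rcases lt_or_eq_of_le hx with hx | hx
        · have hev : Real.smoothTransition =ᶠ[𝓝 ((s - a) / a)] fun _ => (0 : ℝ) := by
            filter_upwards [Iio_mem_nhds hx] with y hy
            exact Real.smoothTransition.zero_of_nonpos (le_of_lt hy)
          rw [hev.deriv_eq, deriv_const]
        · -- minimum point of a differentiable nonnegative function
          rw [hx]
          have hmin : IsLocalMin Real.smoothTransition 0 :=
            Filter.Eventually.of_forall fun y => by
              rw [Real.smoothTransition.zero]; exact Real.smoothTransition.nonneg y
          exact hmin.deriv_eq_zero
      rw [h0, zero_mul]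
    · have h0 : deriv Real.smoothTransition ((s - a) / a) = 0 := by
        have hx : 1 ≤ (s - a) / a := by rw [le_div_iff₀ ha]; linarith
        rcases lt_or_eq_of_le hx with hx | hx
        · have hev : Real.smoothTransition =ᶠ[𝓝 ((s - a) / a)] fun _ => (1 : ℝ) := by
            filter_upwards [Ioi_mem_nhds hx] with y hy
            exact Real.smoothTransition.one_of_one_le (le_of_lt hy)
          rw [hev.deriv_eq, deriv_const]
        · rw [← hx]
          have hmax : IsLocalMax Real.smoothTransition 1 :=
            Filter.Eventually.of_forall fun y => by
              rw [Real.smoothTransition.one]; exact Real.smoothTransition.le_one y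
          exact hmax.deriv_eq_zero
      rw [h0, zero_mul]

/-- The FALLING RAMP `κ₂(s) = ST((2B − s)/B)`: smooth, `1` on `(−∞, B]`, `0` on `[2B, ∞)`, values in `[0,1]`, `|κ₂′| ≤ C/B`, `κ₂′ = 0` off `(B, 2B)`.
[folklore] -/
theorem fallingRamp_props {B : ℝ} (hB : 0 < B) {C : ℝ} (hC : ∀ x : ℝ, |deriv Real.smoothTransition x| ≤ C) :
    ContDiff ℝ (⊤ : ℕ∞) (fun s : ℝ => Real.smoothTransition ((2 * B - s) / B)) ∧
    (∀ s, s ≤ B → Real.smoothTransition ((2 * B - s) / B) = 1) ∧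
    (∀ s, 2 * B ≤ s → Real.smoothTransition ((2 * B - s) / B) = 0) ∧
    (∀ s, 0 ≤ Real.smoothTransition ((2 * B - s) / B) ∧ Real.smoothTransition ((2 * B - s) / B) ≤ 1) ∧
    (∀ s, |deriv (fun s : ℝ => Real.smoothTransition ((2 * B - s) / B)) s| ≤ C / B) ∧
    (∀ s, s ∉ Ioo B (2 * B) → deriv (fun s : ℝ => Real.smoothTransition ((2 * B - s) / B)) s = 0) := by
  have hlin : ∀ s, HasDerivAt (fun s : ℝ => (2 * B - s) / B) (-1 / B) s := fun s => by
    have := ((hasDerivAt_id s).const_sub (2 * B)).div_const B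
    simpa using this
  have hder : ∀ s, HasDerivAt (fun s : ℝ => Real.smoothTransition ((2 * B - s) / B))
      (deriv Real.smoothTransition ((2 * B - s) / B) * (-1 / B)) s := fun s =>
    ((Real.smoothTransition.contDiffAt (n := 1)).differentiableAt (by simp)).hasDerivAt.comp s (hlin s)
  refine ⟨?_, ?_, ?_, ?_, ?_, ?_⟩
  · exact Real.smoothTransition.contDiff.comp ((contDiff_const.sub contDiff_id).div_const B)
  · intro s hs
    exact Real.smoothTransition.one_of_one_le (by rw [le_div_iff₀ hB]; linarith)
  · intro s hs
    exact Real.smoothTransition.zero_of_nonpos (div_nonpos_of_nonpos_of_nonneg (by linarith) hB.le)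
  · exact fun s => ⟨Real.smoothTransition.nonneg _, Real.smoothTransition.le_one _⟩
  · intro s
    rw [(hder s).deriv, abs_mul, show |(-1 : ℝ) / B| = 1 / B by rw [abs_div, abs_neg, abs_one, abs_of_pos hB],
      ← div_eq_mul_one_div]
    exact div_le_div_of_nonneg_right (hC _) hB.le
  · intro s hs
    rw [(hder s).deriv]
    rw [mem_Ioo, not_and_or, not_lt, not_lt] at hs
    rcases hs with hs | hs
    · have h0 : deriv Real.smoothTransition ((2 * B - s) / B) = 0 := by
        have hx : 1 ≤ (2 * B - s) / B := by rw [le_div_iff₀ hB]; linarith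
        rcases lt_or_eq_of_le hx with hx | hx
        · have hev : Real.smoothTransition =ᶠ[𝓝 ((2 * B - s) / B)] fun _ => (1 : ℝ) := by
            filter_upwards [Ioi_mem_nhds hx] with y hy
            exact Real.smoothTransition.one_of_one_le (le_of_lt hy)
          rw [hev.deriv_eq, deriv_const]
        · rw [← hx]
          have hmax : IsLocalMax Real.smoothTransition 1 :=
            Filter.Eventually.of_forall fun y => by
              rw [Real.smoothTransition.one]; exact Real.smoothTransition.le_one y
          exact hmax.deriv_eq_zero
      rw [h0, zero_mul]
    · have h0 : deriv Real.smoothTransition ((2 * B - s) / B) = 0 := by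
        have hx : (2 * B - s) / B ≤ 0 := div_nonpos_of_nonpos_of_nonneg (by linarith) hB.le
        rcases lt_or_eq_of_le hx with hx | hx
        · have hev : Real.smoothTransition =ᶠ[𝓝 ((2 * B - s) / B)] fun _ => (0 : ℝ) := by
            filter_upwards [Iio_mem_nhds hx] with y hy
            exact Real.smoothTransition.zero_of_nonpos (le_of_lt hy)
          rw [hev.deriv_eq, deriv_const]
        · rw [hx]
          have hmin : IsLocalMin Real.smoothTransition 0 :=
            Filter.Eventually.of_forall fun y => by
              rw [Real.smoothTransition.zero]; exact Real.smoothTransition.nonneg y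
          exact hmin.deriv_eq_zero
      rw [h0, zero_mul]

/-! ### 3. The homogeneity-matched weight `θ(s) = κ(s) s^{−m}` -/

/-- A profile vanishing below a positive level times a real power is smooth on all of `ℝ`. [folklore] -/
theorem contDiff_mul_rpow_of_eq_zero {κ : ℝ → ℝ} (hκ : ContDiff ℝ (⊤ : ℕ∞) κ) {a : ℝ} (ha : 0 < a)
    (hκa : ∀ s, s ≤ a → κ s = 0) (m : ℝ) :
    ContDiff ℝ (⊤ : ℕ∞) (fun s : ℝ => κ s * s ^ (-m)) := by
  refine contDiff_iff_contDiffAt.2 fun s => ?_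
  by_cases hs : s < a
  · -- locally zero
    have hev : (fun s : ℝ => κ s * s ^ (-m)) =ᶠ[𝓝 s] fun _ => 0 := by
      filter_upwards [Iio_mem_nhds hs] with σ hσ
      rw [hκa σ (le_of_lt hσ), zero_mul]
    exact (contDiffAt_const.congr_of_eventuallyEq hev)
  · have hs0 : s ≠ 0 := by intro h; rw [h] at hs; exact hs ha
    exact hκ.contDiffAt.mul (Real.contDiffAt_rpow_const_of_ne hs0)

/-- The derivative identity of the homogeneity-matched weight: for `s > 0`,
`2m · θ(s) + 2 s θ′(s) = 2 κ′(s) s^{1−m}`, `θ(s) = κ(s) s^{−m}` (the `κ`-term cancels). [folklore] -/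
theorem weight_deriv_identity {κ : ℝ → ℝ} (hκ : ContDiff ℝ (⊤ : ℕ∞) κ) (m : ℝ) {s : ℝ} (hs : 0 < s) :
    2 * m * (κ s * s ^ (-m)) + 2 * s * deriv (fun s : ℝ => κ s * s ^ (-m)) s = 2 * deriv κ s * s ^ (1 - m) := by
  have hκd : HasDerivAt κ (deriv κ s) s := ((hκ.differentiable (by simp)) s).hasDerivAt
  have hp : HasDerivAt (fun s : ℝ => s ^ (-m)) (-m * s ^ (-m - 1)) s := by
    simpa using Real.hasDerivAt_rpow_const (p := -m) (Or.inl hs.ne')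
  have hprod : HasDerivAt (fun s : ℝ => κ s * s ^ (-m)) (deriv κ s * s ^ (-m) + κ s * (-m * s ^ (-m - 1))) s :=
    hκd.mul hp
  rw [hprod.deriv]
  have e1 : s ^ (1 - m) = s * s ^ (-m) := by
    rw [show (1 : ℝ) - m = 1 + (-m) by ring, Real.rpow_add hs, Real.rpow_one]
  have e2 : s * s ^ (-m - 1) = s ^ (-m) := by
    rw [show -m - 1 = -m + (-1 : ℝ) by ring, Real.rpow_add hs, Real.rpow_neg_one]
    field_simp
  rw [e1]
  have : 2 * s * (deriv κ s * s ^ (-m) + κ s * (-m * s ^ (-m - 1))) =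
      2 * deriv κ s * (s * s ^ (-m)) - 2 * m * κ s * (s * s ^ (-m - 1)) := by ring
  rw [this, e2]
  ring

end Summit.NavierStokesRegularity.NavierStokesRegularity.Theorems.UnthreadedRigidity.ThreadingJets

end
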